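import Literature.Geometry.Riemannian.VolumeSphereTheoremGHDecompositionProofs
import Mathlib.Analysis.SpecialFunctions.Trigonometric.Sinc
import Mathlib.Analysis.SpecialFunctions.Trigonometric.Bounds
import Mathlib.Analysis.Convex.SpecificFunctions.Deriv
import HarnessLib

/-!
# The round sphere is Reifenberg flat: balls of radius `s` in `(Sⁿ, ∠)` are `εs`-close to
Euclidean `n`-balls for `s ≤ min(1, √ε)`

The intrinsic Reifenberg theorem of Cheeger–Colding (*On the structure of spaces with Ricci
curvature bounded below. I*, J. Differential Geom. 46 (1997), Appendix 1, Thms A.1.1–A.1.3) is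
stated for metric spaces all of whose points are `(ε, r)`-Reifenberg points ((4.6), p. 431, and
(A.1.4), p. 457): `d_GH(B_s(z), B_s(0)) < εs` for every `z` and `0 < s ≤ r`, `B_s(0) ⊂ ℝⁿ`. In the
application proving the sphere stability theorem A.1.12 at `Mⁿ = Sⁿ` (the named fact
`CheegerColding1997_sphereStability` of `VolumeSphereTheoremGHDecomposition.lean`, whose seat
writes this file) Thm A.1.3 is applied with `Z₂ = Sⁿ`, which requires the round sphere itself to
lie in the class `𝓜(n, ε, r(ε))`. This file PROVES that hypothesis with the explicit scale
`r(ε) = min(1, √ε)` (`roundSphere_reifenbergFlat`), rendering `d_GH` exactly as the statement file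
does (Colding 1997, *Aspects*, Def. 2.1: an onto map with distortion `≤ εs`, here from the
Euclidean ball to the spherical ball).

## The proof (elementary spherical trigonometry at a point `y ∈ Sⁿ ⊂ V`, `dim V = n + 1`)

* §1 One-variable inequalities: the chord inequality `a sin s ≤ s sin a` (`0 ≤ a ≤ s ≤ π`) of the
  concave sine (Mathlib's `strictConcaveOn_sin_Icc`), `s - sin s ≤ (s²/5) sin s` on `(0, 1]`
  (Mathlib's `sin_gt_sub_cube`), `4 sin²(x/2) = 2 - 2 cos x`, and the `sinc` bookkeeping.
* §2 The exponential map of the unit sphere in closed form, `exp_y(u) = cos|u| · y + sinc|u| · u`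
  for `u ⊥ y` (Lee 2018, Prop. 5.27; the tree's `coe_expMap_roundMetric` of `SphereGeodesics.lean`
  identifies this with `exp` of the round metric — not needed here): it is unit, `∠(y, exp_y u) = |u|`
  (`|u| ≤ π`), the spherical law of cosines `⟪exp_y u, exp_y w⟫ = cos|u| cos|w| + sinc|u| sinc|w| ⟪u, w⟫`,
  and the DISTORTION ESTIMATES on the ball `|u|, |w| ≤ s`: with `λ = sin s / s`,
  `λ|u - w| ≤ |exp_y u - exp_y w| ≤ |u - w|` (`s ≤ π`;
  `norm_sub_le_and_le_of_cos_smul_add_sinc_smul`, from two exact identities expressing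
  `|u - w|² - chord²` and `chord² - λ²|u - w|²` as sums of nonnegative terms) and
  `|∠(exp_y u, exp_y w) - |u - w|| ≤ s² · s` (`s ≤ 1`;
  `abs_angle_sub_norm_sub_le_of_cos_smul_add_sinc_smul`, via `chord = 2 sin(∠/2)`,
  `∠ ≤ |u| + |w| ≤ 2s` and `1/λ - 1 ≤ s²/5`).
* §3 On `Sⁿ ⊂ V`: composing with a linear isometry `ℝⁿ ≅ y^⊥`
  (`stdOrthonormalBasis`, `Submodule.finrank_orthogonal_span_singleton`) gives for `0 < s ≤ 1` a
  map `Φ : ℝⁿ → Sⁿ` with `∠(y, Φ a) = |a|`, onto the ball `∠(y, ·) < s` from the ball `|a| < s`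
  (`exists_eq_cos_angle_smul_add_sin_angle_smul_sphere` of `RoundSphereDistance.lean`) and with
  distortion `≤ s² s` (`exists_euclidean_almostIsometry_ball_roundSphere`); hence the theorem.

No definitions and no named facts are introduced (D-0026).

## References

* J. Cheeger, T. H. Colding, *On the structure of spaces with Ricci curvature bounded below. I*,
  J. Differential Geom. 46 (1997) 406–480: (4.6) (p. 431), Appendix 1, Thms A.1.1–A.1.3 with
  (A.1.4) (p. 457), Thm A.1.12 (p. 459). [CheegerColding1997]
* T. H. Colding, *Aspects of Ricci curvature*, in: Comparison Geometry, MSRI Publ. 30 (1997),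
  Def. 2.1. [Colding1997Aspects]
* J. M. Lee, *Introduction to Riemannian Manifolds*, 2nd ed., Springer GTM 176, 2018, Prop. 5.27,
  Prop. 6.11. [LeeRiemannianManifolds2018]
-/

noncomputable section

open Set Metric Real InnerProductGeometry

namespace Literature.Geometry.Riemannian

/-! ### §1. One-variable inequalities: the chord of the concave sine, `s - sin s ≤ (s²/5) sin s` -/

section OneVariable

/-- **Chords of the concave sine**: for `0 ≤ a ≤ s ≤ π`, `a sin s ≤ s sin a`, i.e.
`sin a / a ≥ sin s / s` (`sin` is concave on `[0, π]`, Mathlib's `strictConcaveOn_sin_Icc`).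
[folklore] -/
theorem mul_sin_le_mul_sin {a s : ℝ} (ha : 0 ≤ a) (has : a ≤ s) (hs : s ≤ π) :
    a * sin s ≤ s * sin a := by
  rcases ha.eq_or_lt with rfl | ha0
  · simp
  have hs0 : 0 < s := ha0.trans_le has
  have hconc := strictConcaveOn_sin_Icc.concaveOn
  have h := hconc.2 (show s ∈ Icc 0 π from ⟨hs0.le, hs⟩) (show (0 : ℝ) ∈ Icc 0 π from
    ⟨le_rfl, pi_pos.le⟩) (show 0 ≤ a / s from div_nonneg ha hs0.le)
    (show 0 ≤ 1 - a / s by rw [sub_nonneg]; exact div_le_one_of_le₀ has hs0.le) (by ring)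
  simp only [smul_eq_mul, mul_zero, add_zero, sin_zero] at h
  rw [div_mul_cancel₀ a hs0.ne'] at h
  calc a * sin s = s * (a / s * sin s) := by field_simp
    _ ≤ s * sin a := mul_le_mul_of_nonneg_left h hs0.le

/-- For `0 < s ≤ 1`: `s - sin s ≤ (s²/5) sin s` (from `sin s > s - s³/6`). [folklore] -/
theorem sub_sin_le_sq_div_five_mul_sin {s : ℝ} (hs0 : 0 < s) (hs1 : s ≤ 1) :
    s - sin s ≤ s ^ 2 / 5 * sin s := by
  have h := sin_gt_sub_cube hs0
  have hs2 : s ^ 2 ≤ 1 := by nlinarith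
  nlinarith [hs0, pow_pos hs0 2, pow_pos hs0 3]

/-- `4 sin²(x/2) = 2 - 2 cos x`. [folklore] -/
theorem four_mul_sin_sq_half (x : ℝ) : 4 * sin (x / 2) ^ 2 = 2 - 2 * cos x := by
  rw [sin_sq_eq_half_sub, show 2 * (x / 2) = x by ring]
  ring

/-- `x sinc x = sin x` for every real `x`. [folklore] -/
theorem mul_sinc (x : ℝ) : x * sinc x = sin x := by
  by_cases hx : x = 0
  · rw [hx, sin_zero, zero_mul]
  · rw [sinc_of_ne_zero hx, mul_div_cancel₀ _ hx]

/-- `sinc` is bounded below on `[0, s]` by `sin s / s` for `s ≤ π`: `a sinc a ≥ …`, precisely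
`sin s / s ≤ sinc a` for `0 ≤ a ≤ s ≤ π`, `0 < s`. [folklore] -/
theorem sin_div_le_sinc {a s : ℝ} (ha : 0 ≤ a) (has : a ≤ s) (hs : s ≤ π) (hs0 : 0 < s) :
    sin s / s ≤ sinc a := by
  rcases ha.eq_or_lt with rfl | ha0
  · rw [sinc_zero]
    exact (div_le_one hs0).2 (sin_le hs0.le)
  · rw [sinc_of_ne_zero ha0.ne', div_le_div_iff₀ hs0 ha0]
    linarith [mul_sin_le_mul_sin ha has hs]

/-- `0 ≤ sinc a` for `0 ≤ a ≤ π`. [folklore] -/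
theorem sinc_nonneg_of_le_pi {a : ℝ} (ha : 0 ≤ a) (haπ : a ≤ π) : 0 ≤ sinc a := by
  rcases ha.eq_or_lt with rfl | ha0
  · rw [sinc_zero]; exact zero_le_one
  · rw [sinc_of_ne_zero ha0.ne']
    exact div_nonneg (sin_nonneg_of_nonneg_of_le_pi ha haπ) ha

end OneVariable

/-! ### §2. The exponential map of the round sphere in closed form and its metric distortion -/

section Vectors

variable {V : Type*} [NormedAddCommGroup V] [InnerProductSpace ℝ V]

local notation "⟪" x ", " y "⟫" => @inner ℝ _ _ x y

/-- `exp_y(u) = cos |u| · y + sinc |u| · u` is a unit vector for `|y| = 1`, `u ⊥ y`.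
[cite: LeeRiemannianManifolds2018, Prop. 5.27] -/
theorem norm_cos_smul_add_sinc_smul {y u : V} (hy : ‖y‖ = 1) (hyu : ⟪y, u⟫ = 0) :
    ‖cos ‖u‖ • y + sinc ‖u‖ • u‖ = 1 := by
  have h2 : ‖cos ‖u‖ • y + sinc ‖u‖ • u‖ ^ 2 = 1 := by
    rw [@norm_add_sq_real, norm_smul, norm_smul, hy, mul_one, inner_smul_left, inner_smul_right,
      hyu, mul_zero, mul_zero, mul_zero, add_zero, norm_eq_abs, norm_eq_abs, mul_pow, sq_abs,
      sq_abs, show sinc ‖u‖ ^ 2 * ‖u‖ ^ 2 = (‖u‖ * sinc ‖u‖) ^ 2 by ring, mul_sinc,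
      cos_sq_add_sin_sq]
  have h0 : 0 ≤ ‖cos ‖u‖ • y + sinc ‖u‖ • u‖ := norm_nonneg _
  nlinarith

/-- `⟪y, exp_y(u)⟫ = cos |u|`. [cite: LeeRiemannianManifolds2018, Prop. 5.27] -/
theorem inner_cos_smul_add_sinc_smul {y u : V} (hy : ‖y‖ = 1) (hyu : ⟪y, u⟫ = 0) :
    ⟪y, cos ‖u‖ • y + sinc ‖u‖ • u⟫ = cos ‖u‖ := by
  rw [inner_add_right, inner_smul_right, inner_smul_right, hyu, mul_zero, add_zero,
    real_inner_self_eq_norm_sq, hy, one_pow, mul_one]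

/-- `∠(y, exp_y(u)) = |u|` for `|u| ≤ π`: the exponential map is a radial isometry.
[cite: LeeRiemannianManifolds2018, Prop. 5.27 and Prop. 6.11] -/
theorem angle_cos_smul_add_sinc_smul {y u : V} (hy : ‖y‖ = 1) (hyu : ⟪y, u⟫ = 0)
    (hu : ‖u‖ ≤ π) : angle y (cos ‖u‖ • y + sinc ‖u‖ • u) = ‖u‖ := by
  rw [angle, inner_cos_smul_add_sinc_smul hy hyu, hy, norm_cos_smul_add_sinc_smul hy hyu,
    mul_one, div_one, arccos_cos (norm_nonneg u) hu]

/-- `⟪exp_y(u), exp_y(w)⟫ = cos|u| cos|w| + sinc|u| sinc|w| ⟪u, w⟫` — the spherical law of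
cosines at `y`. [folklore] -/
theorem inner_cos_smul_add_sinc_smul_cos_smul_add_sinc_smul {y u w : V} (hy : ‖y‖ = 1)
    (hyu : ⟪y, u⟫ = 0) (hyw : ⟪y, w⟫ = 0) :
    ⟪cos ‖u‖ • y + sinc ‖u‖ • u, cos ‖w‖ • y + sinc ‖w‖ • w⟫ =
      cos ‖u‖ * cos ‖w‖ + sinc ‖u‖ * sinc ‖w‖ * ⟪u, w⟫ := by
  have huy : ⟪u, y⟫ = 0 := by rw [real_inner_comm]; exact hyu
  rw [inner_add_left, inner_add_right, inner_add_right, inner_smul_left, inner_smul_left,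
    inner_smul_right, inner_smul_right, inner_smul_left, inner_smul_left, inner_smul_right,
    inner_smul_right, real_inner_self_eq_norm_sq, hy, hyw, huy]
  simp only [conj_trivial, one_pow, mul_one, mul_zero, add_zero, zero_add]
  ring

/-- **The metric distortion of `exp_y` on the ball of radius `s`** (the comparison of the chordal
distance on the sphere with the Euclidean distance in `T_y Sⁿ`): for `|y| = 1`, `u, w ⊥ y` with
`|u|, |w| ≤ s ≤ π`, `0 < s`, writing `λ = sin s / s`,
`λ |u - w| ≤ |exp_y(u) - exp_y(w)| ≤ |u - w|` (spherical law of cosines, `1 - x²/2 ≤ cos x`,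
and the chord inequality of the concave sine). [folklore] -/
theorem norm_sub_le_and_le_of_cos_smul_add_sinc_smul {y u w : V} (hy : ‖y‖ = 1)
    (hyu : ⟪y, u⟫ = 0) (hyw : ⟪y, w⟫ = 0) {s : ℝ} (hs0 : 0 < s) (hsπ : s ≤ π)
    (hus : ‖u‖ ≤ s) (hws : ‖w‖ ≤ s) :
    sin s / s * ‖u - w‖ ≤ ‖(cos ‖u‖ • y + sinc ‖u‖ • u) - (cos ‖w‖ • y + sinc ‖w‖ • w)‖ ∧
      ‖(cos ‖u‖ • y + sinc ‖u‖ • u) - (cos ‖w‖ • y + sinc ‖w‖ • w)‖ ≤ ‖u - w‖ := by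
  set a := ‖u‖ with ha
  set b := ‖w‖ with hb
  set f := ‖u - w‖ with hf
  set lam := sin s / s with hlam
  set E₁ := cos a • y + sinc a • u with hE₁
  set E₂ := cos b • y + sinc b • w with hE₂
  have ha0 : 0 ≤ a := norm_nonneg u
  have hb0 : 0 ≤ b := norm_nonneg w
  have hf0 : 0 ≤ f := norm_nonneg _
  have hE₁1 : ‖E₁‖ = 1 := norm_cos_smul_add_sinc_smul hy hyu
  have hE₂1 : ‖E₂‖ = 1 := norm_cos_smul_add_sinc_smul hy hyw
  -- the inner products
  have hP : ⟪u, w⟫ = (a ^ 2 + b ^ 2 - f ^ 2) / 2 := by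
    rw [hf, @norm_sub_sq_real, ha, hb]; ring
  have hEE : ⟪E₁, E₂⟫ = cos a * cos b + sinc a * sinc b * ⟪u, w⟫ :=
    inner_cos_smul_add_sinc_smul_cos_smul_add_sinc_smul hy hyu hyw
  have hchord : ‖E₁ - E₂‖ ^ 2 = 2 - 2 * (cos a * cos b + sinc a * sinc b * ⟪u, w⟫) := by
    rw [@norm_sub_sq_real, hE₁1, hE₂1, hEE]; ring
  -- the bounds on `sinc a sinc b`
  have hlam0 : 0 ≤ lam := div_nonneg (sin_nonneg_of_nonneg_of_le_pi hs0.le hsπ) hs0.le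
  have hlam1 : lam ≤ 1 := (div_le_one hs0).2 (sin_le hs0.le)
  have hpa : lam ≤ sinc a := sin_div_le_sinc ha0 hus hsπ hs0
  have hpb : lam ≤ sinc b := sin_div_le_sinc hb0 hws hsπ hs0
  have hpa1 : sinc a ≤ 1 := sinc_le_one a
  have hpb1 : sinc b ≤ 1 := sinc_le_one b
  have hpa0 : 0 ≤ sinc a := hlam0.trans hpa
  have hpb0 : 0 ≤ sinc b := hlam0.trans hpb
  have hprod_lo : lam ^ 2 ≤ sinc a * sinc b := by
    rw [sq]; exact mul_le_mul hpa hpb hlam0 hpa0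
  have hprod_hi : sinc a * sinc b ≤ 1 := by
    calc sinc a * sinc b ≤ 1 * 1 := mul_le_mul hpa1 hpb1 hpb0 zero_le_one
      _ = 1 := one_mul 1
  -- the range of `f`: `|a - b| ≤ f`
  have hfab : (a - b) ^ 2 ≤ f ^ 2 := by
    have h := abs_norm_sub_norm_le u w
    rw [← ha, ← hb, ← hf] at h
    calc (a - b) ^ 2 = |a - b| ^ 2 := (sq_abs _).symm
      _ ≤ f ^ 2 := pow_le_pow_left₀ (abs_nonneg _) h 2
  -- `2 - 2 cos(a - b)` against `(a - b)²` and `λ² (a - b)²`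
  have hcossub : cos (a - b) = cos a * cos b + sin a * sin b := cos_sub a b
  have hup0 : 2 - 2 * cos (a - b) ≤ (a - b) ^ 2 := by
    have := one_sub_sq_div_two_le_cos (x := a - b); linarith
  have hlo0 : lam ^ 2 * (a - b) ^ 2 ≤ 2 - 2 * cos (a - b) := by
    rw [← four_mul_sin_sq_half]
    -- `|sin ((a-b)/2)| ≥ λ |a - b| / 2` by the chord inequality (`|a-b|/2 ≤ s`)
    have hx : |a - b| / 2 ≤ s := by
      have : |a - b| ≤ s := by
        rw [abs_sub_le_iff]; constructor <;> linarith
      linarith [abs_nonneg (a - b)]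
    have hch := mul_sin_le_mul_sin (by positivity : 0 ≤ |a - b| / 2) hx hsπ
    -- `sin (|a-b|/2) ≥ lam * |a-b|/2`
    have h1 : lam * (|a - b| / 2) ≤ sin (|a - b| / 2) := by
      rw [hlam, div_mul_eq_mul_div, div_le_iff₀ hs0]
      linarith
    have h2 : sin (|a - b| / 2) ^ 2 = sin ((a - b) / 2) ^ 2 := by
      rcases abs_choice (a - b) with h | h
      · rw [h]
      · rw [h, neg_div, sin_neg, neg_sq]
    have h3 : (lam * (|a - b| / 2)) ^ 2 ≤ sin (|a - b| / 2) ^ 2 :=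
      pow_le_pow_left₀ (by positivity) h1 2
    rw [h2] at h3
    have h4 : (lam * (|a - b| / 2)) ^ 2 = lam ^ 2 * (a - b) ^ 2 / 4 := by
      rw [mul_pow, show (|a - b| / 2) ^ 2 = (a - b) ^ 2 / 4 by rw [div_pow, sq_abs]; norm_num]
      ring
    rw [h4] at h3
    linarith
  -- the key identities
  have hsa : a * sinc a = sin a := mul_sinc a
  have hsb : b * sinc b = sin b := mul_sinc b
  have hid_up : f ^ 2 - ‖E₁ - E₂‖ ^ 2 =
      ((a - b) ^ 2 - (2 - 2 * cos (a - b))) + (1 - sinc a * sinc b) * (f ^ 2 - (a - b) ^ 2) := by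
    rw [hchord, hP, hcossub, ← hsa, ← hsb]; ring
  have hid_lo : ‖E₁ - E₂‖ ^ 2 - lam ^ 2 * f ^ 2 =
      ((2 - 2 * cos (a - b)) - lam ^ 2 * (a - b) ^ 2) +
        (sinc a * sinc b - lam ^ 2) * (f ^ 2 - (a - b) ^ 2) := by
    rw [hchord, hP, hcossub, ← hsa, ← hsb]; ring
  have hE0 : 0 ≤ ‖E₁ - E₂‖ := norm_nonneg _
  constructor
  · -- lower bound
    have h : (lam * f) ^ 2 ≤ ‖E₁ - E₂‖ ^ 2 := by
      have : 0 ≤ ‖E₁ - E₂‖ ^ 2 - lam ^ 2 * f ^ 2 := by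
        rw [hid_lo]
        exact add_nonneg (by linarith) (mul_nonneg (by linarith) (by linarith))
      rw [mul_pow]; linarith
    exact (pow_le_pow_iff_left₀ (mul_nonneg hlam0 hf0) hE0 two_ne_zero).1 h
  · -- upper bound
    have h : ‖E₁ - E₂‖ ^ 2 ≤ f ^ 2 := by
      have : 0 ≤ f ^ 2 - ‖E₁ - E₂‖ ^ 2 := by
        rw [hid_up]
        exact add_nonneg (by linarith) (mul_nonneg (by linarith) (by linarith))
      linarith
    exact pow_le_pow_iff_left₀ hE0 hf0 two_ne_zero |>.1 h

/-- **The angular distortion of `exp_y` on the ball of radius `s ≤ 1`**: for `|y| = 1`,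
`u, w ⊥ y` with `|u|, |w| ≤ s ≤ 1`, `0 < s`,
`|∠(exp_y u, exp_y w) - |u - w|| ≤ s² · s` — i.e. the exponential map of the unit sphere restricted
to the ball of radius `s` distorts the intrinsic distance `∠` against the Euclidean one by
`O(s³) = o(s)`. Proof: with `λ = sin s / s`, `c = |exp_y u - exp_y w| = 2 sin(∠/2)`:
`λ|u - w| ≤ c ≤ ∠` (`norm_sub_le_and_le_of_cos_smul_add_sinc_smul`, `norm_sub_le_angle`) and
`λ ∠ ≤ c ≤ |u - w|` (`∠ ≤ |u| + |w| ≤ 2s` by the triangle inequality for angles through `y`, and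
the chord inequality for `sin` at `∠/2 ≤ s`), while `1/λ - 1 ≤ s²/5` (`sin s ≥ s - s³/6`).
[folklore] -/
theorem abs_angle_sub_norm_sub_le_of_cos_smul_add_sinc_smul {y u w : V} (hy : ‖y‖ = 1)
    (hyu : ⟪y, u⟫ = 0) (hyw : ⟪y, w⟫ = 0) {s : ℝ} (hs0 : 0 < s) (hs1 : s ≤ 1)
    (hus : ‖u‖ ≤ s) (hws : ‖w‖ ≤ s) :
    |angle (cos ‖u‖ • y + sinc ‖u‖ • u) (cos ‖w‖ • y + sinc ‖w‖ • w) - ‖u - w‖| ≤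
      s ^ 2 * s := by
  have hsπ : s ≤ π := hs1.trans (by linarith [Real.two_le_pi])
  set a := ‖u‖ with ha
  set b := ‖w‖ with hb
  set f := ‖u - w‖ with hf
  set lam := sin s / s with hlam
  set E₁ := cos a • y + sinc a • u with hE₁
  set E₂ := cos b • y + sinc b • w with hE₂
  set θ := angle E₁ E₂ with hθ
  have ha0 : 0 ≤ a := norm_nonneg u
  have hb0 : 0 ≤ b := norm_nonneg w
  have hf0 : 0 ≤ f := norm_nonneg _
  have hE₁1 : ‖E₁‖ = 1 := norm_cos_smul_add_sinc_smul hy hyu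
  have hE₂1 : ‖E₂‖ = 1 := norm_cos_smul_add_sinc_smul hy hyw
  have hsin0 : 0 < sin s := sin_pos_of_pos_of_lt_pi hs0 (hs1.trans_lt (by linarith [Real.two_le_pi]))
  have hlam0 : 0 < lam := div_pos hsin0 hs0
  have hlam1 : lam ≤ 1 := (div_le_one hs0).2 (sin_le hs0.le)
  obtain ⟨hlo, hup⟩ := norm_sub_le_and_le_of_cos_smul_add_sinc_smul hy hyu hyw hs0 hsπ hus hws
  -- the chord `c = 2 sin(θ/2)` and the angle
  have hc : ‖E₁ - E₂‖ = 2 * sin (θ / 2) := norm_sub_eq_two_mul_sin_half_angle hE₁1 hE₂1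
  have hcθ : ‖E₁ - E₂‖ ≤ θ := norm_sub_le_angle hE₁1 hE₂1
  have hθ0 : 0 ≤ θ := angle_nonneg _ _
  -- `θ ≤ a + b ≤ 2s`
  have hθab : θ ≤ a + b := by
    have h1 : angle E₁ y = a := by
      rw [angle_comm]; exact angle_cos_smul_add_sinc_smul hy hyu (hus.trans hsπ)
    have h2 : angle y E₂ = b := angle_cos_smul_add_sinc_smul hy hyw (hws.trans hsπ)
    have h := angle_le_angle_add_angle E₁ y E₂
    rw [h1, h2] at h
    exact h
  -- `λ θ ≤ c`
  have hlamθ : lam * θ ≤ ‖E₁ - E₂‖ := by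
    rw [hc]
    have hx : θ / 2 ≤ s := by linarith
    have hch := mul_sin_le_mul_sin (by positivity : 0 ≤ θ / 2) hx hsπ
    rw [hlam]
    rw [div_mul_eq_mul_div, div_le_iff₀ hs0]
    linarith
  -- `1/λ - 1 ≤ s²/5`, in the forms used below
  have hkey := sub_sin_le_sq_div_five_mul_sin hs0 hs1
  have hfab : f ≤ 2 * s := by
    calc f ≤ a + b := norm_sub_le u w
      _ ≤ 2 * s := by linarith
  rw [abs_sub_le_iff]
  constructor
  · -- `θ - f ≤ s² s`: from `λ θ ≤ c ≤ f`, `θ - f ≤ f (1 - λ)/λ = f (s - sin s)/sin s ≤ f s²/5`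
    have h1 : lam * θ ≤ f := hlamθ.trans hup
    have h2 : sin s * θ ≤ s * f := by
      have := mul_le_mul_of_nonneg_left h1 hs0.le
      rw [hlam, ← mul_assoc, mul_div_cancel₀ _ hs0.ne'] at this
      exact this
    -- `sin s (θ - f) ≤ (s - sin s) f ≤ (s²/5) sin s f`
    have h3 : sin s * (θ - f) ≤ s ^ 2 / 5 * sin s * f := by nlinarith
    have h4 : θ - f ≤ s ^ 2 / 5 * f := by
      have := h3
      rw [show s ^ 2 / 5 * sin s * f = sin s * (s ^ 2 / 5 * f) by ring] at this
      exact le_of_mul_le_mul_left this hsin0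
    calc θ - f ≤ s ^ 2 / 5 * f := h4
      _ ≤ s ^ 2 / 5 * (2 * s) := mul_le_mul_of_nonneg_left hfab (by positivity)
      _ ≤ s ^ 2 * s := by nlinarith [pow_pos hs0 2]
  · -- `f - θ ≤ s² s`: from `λ f ≤ c ≤ θ`, `f - θ ≤ f (1 - λ) = f (s - sin s)/s ≤ f s²/5`
    have h1 : lam * f ≤ θ := hlo.trans hcθ
    have h2 : sin s * f ≤ s * θ := by
      have := mul_le_mul_of_nonneg_left h1 hs0.le
      rw [hlam, ← mul_assoc, mul_div_cancel₀ _ hs0.ne'] at this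
      exact this
    have h3 : s * (f - θ) ≤ (s - sin s) * f := by nlinarith
    have h4 : s * (f - θ) ≤ s * (s ^ 2 / 5 * f) := by
      calc s * (f - θ) ≤ (s - sin s) * f := h3
        _ ≤ s ^ 2 / 5 * sin s * f := mul_le_mul_of_nonneg_right hkey hf0
        _ ≤ s ^ 2 / 5 * s * f := by
            apply mul_le_mul_of_nonneg_right _ hf0
            exact mul_le_mul_of_nonneg_left (sin_le hs0.le) (by positivity)
        _ = s * (s ^ 2 / 5 * f) := by ring
    have h5 : f - θ ≤ s ^ 2 / 5 * f := le_of_mul_le_mul_left h4 hs0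
    calc f - θ ≤ s ^ 2 / 5 * f := h5
      _ ≤ s ^ 2 / 5 * (2 * s) := mul_le_mul_of_nonneg_left hfab (by positivity)
      _ ≤ s ^ 2 * s := by nlinarith [pow_pos hs0 2]

end Vectors

/-! ### §3. The round `n`-sphere: every ball of radius `s ≤ min(1, √ε)` is `εs`-approximated by
the Euclidean `n`-ball -/

section Sphere

open Module

variable {V : Type*} [NormedAddCommGroup V] [InnerProductSpace ℝ V] {n : ℕ}
  [Fact (finrank ℝ V = n + 1)]

local notation "⟪" x ", " y "⟫" => @inner ℝ _ _ x y

/-- **The exponential map of the round sphere as an almost isometry from the Euclidean `n`-ball**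
(Lee 2018, Prop. 5.27 / Prop. 6.11 for the closed form and the radial isometry; the distortion
estimate is `abs_angle_sub_norm_sub_le_of_cos_smul_add_sinc_smul`). For `n ≥ 1`, a point `y` of
the unit sphere `Sⁿ ⊂ V` (`dim V = n + 1`) and `0 < s ≤ 1` there is a map `Φ : ℝⁿ → Sⁿ`
(`Φ = exp_y ∘ L` for a linear isometry `L : ℝⁿ ≅ y^⊥`) with: `∠(y, Φ a) = |a|` for `|a| ≤ π`
(so `Φ` maps the ball `|a| < s` into the ball `∠(y, ·) < s`); every `x` with `∠(y, x) < s` is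
`Φ a` for some `|a| < s`; and `|∠(Φ a, Φ b) - |a - b|| ≤ s² · s` for `|a|, |b| ≤ s`.
[cite: LeeRiemannianManifolds2018, Prop. 5.27 and Prop. 6.11] -/
theorem exists_euclidean_almostIsometry_ball_roundSphere (hn : 1 ≤ n)
    (y : sphere (0 : V) 1) {s : ℝ} (hs0 : 0 < s) (hs1 : s ≤ 1) :
    ∃ Φ : EuclideanSpace ℝ (Fin n) → sphere (0 : V) 1,
      (∀ a : EuclideanSpace ℝ (Fin n), ‖a‖ ≤ π → angle (y : V) (Φ a) = ‖a‖) ∧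
      (∀ x : sphere (0 : V) 1, angle (y : V) x < s →
        ∃ a : EuclideanSpace ℝ (Fin n), ‖a‖ < s ∧ Φ a = x) ∧
      (∀ a b : EuclideanSpace ℝ (Fin n), ‖a‖ ≤ s → ‖b‖ ≤ s →
        |angle (Φ a : V) (Φ b) - ‖a - b‖| ≤ s ^ 2 * s) := by
  haveI : FiniteDimensional ℝ V := .of_fact_finrank_eq_succ n
  have hy : ‖(y : V)‖ = 1 := norm_eq_one_of_mem_sphere y
  have hy0 : (y : V) ≠ 0 := by
    intro h; rw [h, norm_zero] at hy; exact zero_ne_one hy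
  set K : Submodule ℝ V := (ℝ ∙ (y : V))ᗮ with hK
  have hrank : finrank ℝ K = n := Submodule.finrank_orthogonal_span_singleton hy0
  set L : EuclideanSpace ℝ (Fin n) ≃ₗᵢ[ℝ] K :=
    ((stdOrthonormalBasis ℝ K).reindex (finCongr hrank)).repr.symm with hL
  have hLmem : ∀ a : EuclideanSpace ℝ (Fin n), ⟪(y : V), (L a : V)⟫ = 0 := fun a ↦
    Submodule.mem_orthogonal_singleton_iff_inner_right.1 (L a).2
  have hLnorm : ∀ a : EuclideanSpace ℝ (Fin n), ‖(L a : V)‖ = ‖a‖ := fun a ↦ by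
    rw [Submodule.norm_coe, LinearIsometryEquiv.norm_map]
  have hLsub : ∀ a b : EuclideanSpace ℝ (Fin n), ‖(L a : V) - (L b : V)‖ = ‖a - b‖ := fun a b ↦ by
    rw [← Submodule.coe_sub, ← map_sub, Submodule.norm_coe, LinearIsometryEquiv.norm_map]
  set Φ : EuclideanSpace ℝ (Fin n) → sphere (0 : V) 1 := fun a ↦
    ⟨cos ‖(L a : V)‖ • (y : V) + sinc ‖(L a : V)‖ • (L a : V), by
      rw [mem_sphere_zero_iff_norm]
      exact norm_cos_smul_add_sinc_smul hy (hLmem a)⟩ with hΦ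
  have hΦ_apply : ∀ a, (Φ a : V) = cos ‖(L a : V)‖ • (y : V) + sinc ‖(L a : V)‖ • (L a : V) :=
    fun a ↦ rfl
  refine ⟨Φ, fun a ha ↦ ?_, fun x hx ↦ ?_, fun a b ha hb ↦ ?_⟩
  · -- radial isometry
    rw [hΦ_apply, angle_cos_smul_add_sinc_smul hy (hLmem a) (by rw [hLnorm]; exact ha), hLnorm]
  · -- surjectivity onto the ball
    obtain ⟨u, hu1, hyu, hxu⟩ := exists_eq_cos_angle_smul_add_sin_angle_smul_sphere hn y x
    set θ := angle (y : V) x with hθ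
    have hθ0 : 0 ≤ θ := angle_nonneg _ _
    have huK : θ • u ∈ K := K.smul_mem θ (Submodule.mem_orthogonal_singleton_iff_inner_right.2 hyu)
    set a : EuclideanSpace ℝ (Fin n) := L.symm ⟨θ • u, huK⟩ with ha
    have hLa : (L a : V) = θ • u := by
      rw [ha, LinearIsometryEquiv.apply_symm_apply]
    have hna : ‖a‖ = θ := by
      rw [← hLnorm a, hLa, norm_smul, hu1, mul_one, norm_eq_abs, abs_of_nonneg hθ0]
    refine ⟨a, by rw [hna]; exact hx, Subtype.ext ?_⟩
    rw [hΦ_apply, hLa, norm_smul, hu1, mul_one, norm_eq_abs, abs_of_nonneg hθ0, smul_smul,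
      mul_comm (sinc θ) θ, mul_sinc, hxu]
  · -- distortion
    have h := abs_angle_sub_norm_sub_le_of_cos_smul_add_sinc_smul hy (hLmem a) (hLmem b) hs0 hs1
      (by rw [hLnorm]; exact ha) (by rw [hLnorm]; exact hb)
    rwa [hLsub] at h

/-- **The round sphere is Reifenberg flat** (the hypothesis `Z₂ = Sⁿ ∈ 𝓜(n, ε, r)` of the
intrinsic Reifenberg theorem, Cheeger–Colding 1997, Appendix 1, Thm. A.1.3 with (A.1.4) and
Def. (4.6): every point is an `(ε, r)`-Reifenberg point, `d_GH(B_s(z), B_s(0)) < εs` for all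
`0 < s ≤ r`, `B_s(0) ⊂ ℝⁿ`; a smooth compact manifold lies in `𝓜(n, ε, r(ε))` — here for the model
space itself, with explicit `r(ε) = min(1, √ε)`). For `n ≥ 1` and `ε > 0` put `r = min(1, √ε)`;
then for every point `y` of the unit round sphere `(Sⁿ, ∠)` and every `0 < s ≤ r` there is a map
`Φ` from `ℝⁿ` to `Sⁿ` carrying the ball `|a| < s` into the ball `∠(y, ·) < s` and ONTO it, with
distortion `|∠(Φ a, Φ b) - |a - b|| ≤ ε s` for `|a|, |b| < s` — an `εs`-Gromov–Hausdorff
approximation between the two balls in the sense of Colding 1997, Def. 2.1 (the rendering of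
`d_GH` used by `IsRoundSphereGHApprox`). [cite: CheegerColding1997, Appendix 1, Thm. A.1.3 and
(A.1.4) (p. 457); (4.6) (p. 431)] -/
theorem roundSphere_reifenbergFlat (hn : 1 ≤ n) {ε : ℝ} (hε : 0 < ε) :
    ∃ r : ℝ, 0 < r ∧ ∀ (y : sphere (0 : V) 1) (s : ℝ), 0 < s → s ≤ r →
      ∃ Φ : EuclideanSpace ℝ (Fin n) → sphere (0 : V) 1,
        (∀ a : EuclideanSpace ℝ (Fin n), ‖a‖ < s → angle (y : V) (Φ a) < s) ∧
        (∀ x : sphere (0 : V) 1, angle (y : V) x < s →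
          ∃ a : EuclideanSpace ℝ (Fin n), ‖a‖ < s ∧ Φ a = x) ∧
        (∀ a b : EuclideanSpace ℝ (Fin n), ‖a‖ < s → ‖b‖ < s →
          |angle (Φ a : V) (Φ b) - ‖a - b‖| ≤ ε * s) := by
  refine ⟨min 1 (Real.sqrt ε), lt_min one_pos (Real.sqrt_pos.2 hε), fun y s hs0 hsr ↦ ?_⟩
  have hs1 : s ≤ 1 := hsr.trans (min_le_left _ _)
  have hsε : s ^ 2 ≤ ε := by
    have h1 : s ≤ Real.sqrt ε := hsr.trans (min_le_right _ _)
    calc s ^ 2 ≤ Real.sqrt ε ^ 2 := pow_le_pow_left₀ hs0.le h1 2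
      _ = ε := Real.sq_sqrt hε.le
  have hsπ : s ≤ π := hs1.trans (by linarith [Real.two_le_pi])
  obtain ⟨Φ, hrad, hsurj, hdist⟩ := exists_euclidean_almostIsometry_ball_roundSphere hn y hs0 hs1
  refine ⟨Φ, fun a ha ↦ ?_, hsurj, fun a b ha hb ↦ ?_⟩
  · rw [hrad a (ha.le.trans hsπ)]; exact ha
  · calc |angle (Φ a : V) (Φ b) - ‖a - b‖| ≤ s ^ 2 * s := hdist a b ha.le hb.le
      _ ≤ ε * s := mul_le_mul_of_nonneg_right hsε hs0.le

end Sphere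

end Literature.Geometry.Riemannian
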